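import Mathlib.NumberTheory.Chebyshev
import Mathlib.Analysis.SpecialFunctions.Pow.Real
import Literature.IUT.LogVolume.PrimeNumberEstimates
import HarnessLib

/-!
# [IUTchIV] Corollary 2.2 (ii), proof: the choice of the prime `l` — properties (P1), (P2), (P3)

Mochizuki, *Inter-universal Teichmüller theory IV*, RIMS manuscript (Apr. 2020; = PRIMS **57** (2021)),
proof of Cor. 2.2 (ii), pp. 44–45: from "Next, let us write `h := log(q^∀) = (1/[F:ℚ])·Σ_{v∈𝕍(F)^non}
h_v·f_v·log(p_v)`" to "(P3) if `l = p_v` for some `v ∈ 𝕍(F)^non`, then `h_v < h^{1/2}`". Classical content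
(Chebyshev/PNT bookkeeping); TAKES NO SIDE on anything disputed (no Θ-data occur here).

Printed argument. With `h^{1/2} ≥ ξ_prm ≥ 5` and `[F:ℚ] ≤ δ`: "`δ·h^{1/2} ≥ [F:ℚ]·h^{1/2} = Σ_v h^{−1/2}·h_v·f_v·
log(p_v) ≥ … ≥ Σ_{h_v ≥ h^{1/2}} log(p_v)`" and "`2δ·h^{1/2}·log(2δ·h) ≥ 2·[F:ℚ]·h^{1/2}·log(2·[F:ℚ]·h) ≥ Σ_{h_v≠0}
2·h^{−1/2}·log(2·h_v·f_v·log(p_v))·h_v·f_v·log(p_v) ≥ Σ_{h_v≠0} h^{−1/2}·log(h_v)·h_v ≥ Σ_{h_v ≥ h^{1/2}} h^{−1/2}·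
log(h_v)·h_v ≥ Σ_{h_v ≥ h^{1/2}} log(h_v)` — where … we apply the elementary estimate `2·log(p_v) ≥ 2·log(2) =
log(4) ≥ 1`". Then with `A` := the primes `p` that (S1) are `≤ h^{1/2}`, (S2) divide a nonzero `h_v`, or (S3)
equal `p_v` for some `v` with `h_v ≥ h^{1/2}`: "`θ_A ≤ 2·h^{1/2} + δ·h^{1/2} + 2δ·h^{1/2}·log(2δ·h) ≤ 4δ·h^{1/2}·
log(2δ·h) ≤ −ξ_prm + 5δ·h^{1/2}·log(2δ·h)`", so Prop. 2.1 (ii) gives a prime `l ∉ A`, `l ≤ 2(θ_A + ξ_prm)`: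
"(P1) `(5 ≤) h^{1/2} ≤ l ≤ 10δ·h^{1/2}·log(2δ·h)`; (P2) `l` does not divide any nonzero `h_v`; (P3) if `l = p_v`
… then `h_v < h^{1/2}`." (A prime dividing `h_v < h^{1/2}` is `≤ h^{1/2}`, so (S2) only matters for
`h_v ≥ h^{1/2}`, where `Σ_{p | h_v} log p ≤ log(h_v)`.)

PROVED here (`exists_prime_P1_P2_P3`) over abstract data: a finite index set `V` (the `v` with `h_v ≠ 0`
may be taken; zeros are harmless), `h_v ∈ ℕ`, `f_v ≥ 1`, primes `p_v`, `d = [F:ℚ] ≥ 1` with `d ≤ δ`, `δ ≥ 2`,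
`d·h = Σ_v h_v·f_v·log(p_v)`, and `ξ_prm ≤ h^{1/2}` with `IsXiPrm ξ_prm` (Prop. 2.1 (ii), PROVED in
`PrimeNumberEstimates.lean`). Deliberately NOT here: (P4)–(P7) (no `l`-cyclic subgroup, `𝕍^bad_mod ≠ ∅`,
`SL₂(𝔽_l)` image, existence of initial Θ-data) — they need [GenEll] §3 and [IUTchI] Def. 3.1.
-/

noncomputable section

namespace Literature.IUT.LogVolume

namespace Cor22

open Real Finset
open scoped Nat.Prime Chebyshev

/-! ## Three small summation lemmas -/

/-- `Σ_{p ∈ f(s)} g(p) ≤ Σ_{x ∈ s} g(f x)` for `g ≥ 0`. [folklore] -/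
private theorem sum_image_le_sum {ι : Type*} [DecidableEq ι] (s : Finset ι) (f : ι → ℕ) (g : ℕ → ℝ)
    (hg : ∀ n, 0 ≤ g n) : ∑ p ∈ s.image f, g p ≤ ∑ x ∈ s, g (f x) := by
  induction s using Finset.induction_on with
  | empty => simp
  | insert a s ha ih =>
    rw [Finset.image_insert, Finset.sum_insert ha]
    by_cases hm : f a ∈ s.image f
    · rw [Finset.insert_eq_of_mem hm]; linarith [hg (f a)]
    · rw [Finset.sum_insert hm]; linarith

/-- `Σ_{p ∈ ⋃_{x∈s} t(x)} g(p) ≤ Σ_{x ∈ s} Σ_{p ∈ t(x)} g(p)` for `g ≥ 0`. [folklore] -/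
private theorem sum_biUnion_le_sum {ι : Type*} [DecidableEq ι] (s : Finset ι) (t : ι → Finset ℕ)
    (g : ℕ → ℝ) (hg : ∀ n, 0 ≤ g n) : ∑ p ∈ s.biUnion t, g p ≤ ∑ x ∈ s, ∑ p ∈ t x, g p := by
  induction s using Finset.induction_on with
  | empty => simp
  | insert a s ha ih =>
    rw [Finset.biUnion_insert, Finset.sum_insert ha]
    have hu : ∑ p ∈ t a ∪ s.biUnion t, g p ≤ ∑ p ∈ t a, g p + ∑ p ∈ s.biUnion t, g p := by
      rw [← Finset.sum_union_inter]
      have : 0 ≤ ∑ p ∈ t a ∩ s.biUnion t, g p := Finset.sum_nonneg fun p _ => hg p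
      linarith
    linarith

/-- `Σ_{p ∈ A ∪ B ∪ C} g ≤ Σ_A g + Σ_B g + Σ_C g` for `g ≥ 0`. [folklore] -/
private theorem sum_union3_le (A B C : Finset ℕ) (g : ℕ → ℝ) (hg : ∀ n, 0 ≤ g n) :
    ∑ p ∈ A ∪ B ∪ C, g p ≤ ∑ p ∈ A, g p + ∑ p ∈ B, g p + ∑ p ∈ C, g p := by
  have h1 : ∑ p ∈ A ∪ B ∪ C, g p ≤ ∑ p ∈ A ∪ B, g p + ∑ p ∈ C, g p := by
    rw [← Finset.sum_union_inter]
    have : 0 ≤ ∑ p ∈ (A ∪ B) ∩ C, g p := Finset.sum_nonneg fun p _ => hg p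
    linarith
  have h2 : ∑ p ∈ A ∪ B, g p ≤ ∑ p ∈ A, g p + ∑ p ∈ B, g p := by
    rw [← Finset.sum_union_inter]
    have : 0 ≤ ∑ p ∈ A ∩ B, g p := Finset.sum_nonneg fun p _ => hg p
    linarith
  linarith

/-- For `n ≥ 1`: `Σ_{p | n} log p = log(∏_{p | n} p) ≤ log n` (the radical divides `n`). [folklore] -/
private theorem sum_log_primeFactors_le {n : ℕ} (hn : n ≠ 0) :
    ∑ p ∈ n.primeFactors, Real.log p ≤ Real.log n := by
  have hprod : (∏ p ∈ n.primeFactors, (p : ℝ)) = ((∏ p ∈ n.primeFactors, p : ℕ) : ℝ) := by push_cast; rfl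
  rw [← Real.log_prod (s := n.primeFactors) (f := fun p : ℕ => (p : ℝ)) (fun p hp =>
    by exact_mod_cast (Nat.prime_of_mem_primeFactors hp).ne_zero), hprod]
  apply Real.log_le_log
  · exact_mod_cast Finset.prod_pos fun p hp => (Nat.prime_of_mem_primeFactors hp).pos
  · exact_mod_cast Nat.le_of_dvd (Nat.pos_of_ne_zero hn) (Nat.prod_primeFactors_dvd n)

/-! ## The data and the prime `l` -/

/-- The data of the prime-choice step of the proof of Cor. 2.2 (ii) (p. 44): a finite set `V` of
nonarchimedean primes `v` of `F` with the local heights `h_v ∈ ℕ` ("`h_v = 0` for those `v` at which `E_F`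
has good reduction; `h_v ∈ ℕ_{≥1}` … the local height … for those `v` at which `E_F` has bad multiplicative
reduction"), residue degrees `f_v ≥ 1`, residue characteristics `p_v`; `d = [F:ℚ]` with `d ≤ δ`
("`[F : ℚ] ≤ δ`", p. 44), `δ ≥ 2`; `h = log(q^∀)` with `[F:ℚ]·h = Σ_v h_v·f_v·log(p_v)`; and `ξ_prm` of Prop.
2.1 (ii) with "`h^{1/2} ≥ ξ_prm ≥ 5`". [claim: Mochizuki2012, status: disputed] -/
structure PrimeChoiceData where
  /-- index type of the nonarchimedean primes of `F` -/
  ι : Type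
  /-- decidable equality (for finite-set bookkeeping) -/
  instDecEq : DecidableEq ι
  /-- the finite set of `v` considered -/
  V : Finset ι
  /-- local heights `h_v` -/
  hv : ι → ℕ
  /-- residue degrees `f_v` -/
  fv : ι → ℕ
  /-- `f_v ≥ 1` -/
  one_le_fv : ∀ v ∈ V, 1 ≤ fv v
  /-- residue characteristics `p_v` -/
  pv : ι → ℕ
  /-- `p_v` is prime -/
  pv_prime : ∀ v ∈ V, (pv v).Prime
  /-- `d = [F:ℚ]` -/
  d : ℕ
  /-- `d ≥ 1` -/
  one_le_d : 1 ≤ d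
  /-- `δ` -/
  δ : ℝ
  /-- `δ ≥ 2` -/
  two_le_δ : 2 ≤ δ
  /-- `[F:ℚ] ≤ δ` -/
  d_le_δ : (d : ℝ) ≤ δ
  /-- `h = log(q^∀)` -/
  h : ℝ
  /-- `[F:ℚ]·h = Σ_v h_v·f_v·log(p_v)` -/
  h_def : (d : ℝ) * h = ∑ v ∈ V, (hv v : ℝ) * (fv v : ℝ) * Real.log (pv v)
  /-- `ξ_prm` -/
  ξ : ℝ
  /-- Prop. 2.1 (ii) for `ξ_prm` -/
  isXiPrm : IsXiPrm ξ
  /-- "`h^{1/2} ≥ ξ_prm`" -/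
  ξ_le_sqrt : ξ ≤ Real.sqrt h

attribute [instance] PrimeChoiceData.instDecEq

namespace PrimeChoiceData

variable (A : PrimeChoiceData)

/-- `s := h^{1/2} ≥ 5`. [claim: Mochizuki2012, status: disputed] -/
theorem five_le_sqrt : 5 ≤ Real.sqrt A.h := le_trans A.isXiPrm.1 A.ξ_le_sqrt

/-- `h ≥ 25 > 0`. [folklore] -/
private theorem h_pos : 0 < A.h := by
  have h5 := A.five_le_sqrt
  by_contra hle
  rw [not_lt] at hle
  rw [Real.sqrt_eq_zero'.mpr hle] at h5
  linarith

/-- `(√h)² = h`. [folklore] -/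
private theorem sq_sqrt_h : Real.sqrt A.h ^ 2 = A.h := Real.sq_sqrt A.h_pos.le

/-- `log(2δh) ≥ 1`. [folklore] -/
private theorem one_le_log : 1 ≤ Real.log (2 * A.δ * A.h) := by
  have hs := A.five_le_sqrt
  have hh : 25 ≤ A.h := by nlinarith [A.sq_sqrt_h]
  have h4 : (4 : ℝ) ≤ 2 * A.δ * A.h := by nlinarith [A.two_le_δ]
  have he : Real.exp 1 ≤ 4 := by have := Real.exp_one_lt_d9; linarith
  calc (1 : ℝ) = Real.log (Real.exp 1) := (Real.log_exp 1).symm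
    _ ≤ Real.log 4 := Real.log_le_log (Real.exp_pos 1) he
    _ ≤ Real.log (2 * A.δ * A.h) := Real.log_le_log (by norm_num) h4

/-- Each term of `Σ_v h_v f_v log(p_v)` is `≥ 0`. [folklore] -/
private theorem term_nonneg (v : A.ι) (_hvV : v ∈ A.V) :
    0 ≤ (A.hv v : ℝ) * (A.fv v : ℝ) * Real.log (A.pv v) := by
  have := Real.log_natCast_nonneg (A.pv v); positivity

/-- (S3)-estimate (p. 44): `Σ_{h_v ≥ h^{1/2}} log(p_v) ≤ δ·h^{1/2}`. [claim: Mochizuki2012, status: disputed] -/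
theorem sum_log_pv_le :
    ∑ v ∈ A.V.filter (fun v => Real.sqrt A.h ≤ A.hv v), Real.log (A.pv v) ≤ A.δ * Real.sqrt A.h := by
  have hs := A.five_le_sqrt
  have hs0 : 0 < Real.sqrt A.h := by linarith
  -- `√h · Σ_{h_v ≥ √h} log p_v ≤ Σ_{h_v ≥ √h} h_v f_v log p_v ≤ Σ_v h_v f_v log p_v = d h ≤ δ h`
  have h1 : Real.sqrt A.h * ∑ v ∈ A.V.filter (fun v => Real.sqrt A.h ≤ A.hv v), Real.log (A.pv v) ≤
      ∑ v ∈ A.V.filter (fun v => Real.sqrt A.h ≤ A.hv v), (A.hv v : ℝ) * (A.fv v : ℝ) * Real.log (A.pv v) := by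
    rw [Finset.mul_sum]
    refine Finset.sum_le_sum fun v hv => ?_
    rw [Finset.mem_filter] at hv
    have hf : (1 : ℝ) ≤ A.fv v := by exact_mod_cast A.one_le_fv v hv.1
    have hl : 0 ≤ Real.log (A.pv v : ℝ) := Real.log_natCast_nonneg _
    have a : Real.sqrt A.h * Real.log (A.pv v) ≤ (A.hv v : ℝ) * Real.log (A.pv v) :=
      mul_le_mul_of_nonneg_right hv.2 hl
    have b : (A.hv v : ℝ) * Real.log (A.pv v) * 1 ≤ (A.hv v : ℝ) * Real.log (A.pv v) * (A.fv v : ℝ) :=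
      mul_le_mul_of_nonneg_left hf (mul_nonneg (by positivity) hl)
    have e : (A.hv v : ℝ) * (A.fv v : ℝ) * Real.log (A.pv v) = (A.hv v : ℝ) * Real.log (A.pv v) * (A.fv v : ℝ) := by
      ring
    rw [e]; linarith
  have h2 : ∑ v ∈ A.V.filter (fun v => Real.sqrt A.h ≤ A.hv v), (A.hv v : ℝ) * (A.fv v : ℝ) * Real.log (A.pv v)
      ≤ (A.d : ℝ) * A.h := by
    rw [A.h_def]
    exact Finset.sum_le_sum_of_subset_of_nonneg (Finset.filter_subset _ _) fun v hv _ => A.term_nonneg v hv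
  have h3 : (A.d : ℝ) * A.h ≤ A.δ * A.h := mul_le_mul_of_nonneg_right A.d_le_δ A.h_pos.le
  have h4 : A.δ * A.h = A.δ * Real.sqrt A.h * Real.sqrt A.h := by rw [mul_assoc, ← sq, A.sq_sqrt_h]
  have : Real.sqrt A.h * ∑ v ∈ A.V.filter (fun v => Real.sqrt A.h ≤ A.hv v), Real.log (A.pv v) ≤
      (A.δ * Real.sqrt A.h) * Real.sqrt A.h := by linarith
  rw [mul_comm] at this
  exact le_of_mul_le_mul_right this hs0

/-- (S2)-estimate (p. 44): `Σ_{h_v ≥ h^{1/2}} log(h_v) ≤ 2δ·h^{1/2}·log(2δ·h)` — via "`2·log(p_v) ≥ 2·log(2) =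
log(4) ≥ 1`" and `2·[F:ℚ]·h ≥ 2·h_v·f_v·log(p_v)`. [claim: Mochizuki2012, status: disputed] -/
theorem sum_log_hv_le :
    ∑ v ∈ A.V.filter (fun v => Real.sqrt A.h ≤ A.hv v), Real.log (A.hv v) ≤
      2 * A.δ * Real.sqrt A.h * Real.log (2 * A.δ * A.h) := by
  have hs := A.five_le_sqrt
  have hs0 : 0 < Real.sqrt A.h := by linarith
  have hhpos := A.h_pos
  have hlog1 := A.one_le_log
  set W := A.V.filter (fun v => Real.sqrt A.h ≤ A.hv v) with hW
  -- termwise: `√h · log(h_v) ≤ h_v · log(h_v) ≤ 2 h_v f_v log(p_v) · log(2 d h)`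
  have hterm : ∀ v ∈ W, Real.sqrt A.h * Real.log (A.hv v) ≤
      2 * ((A.hv v : ℝ) * (A.fv v : ℝ) * Real.log (A.pv v)) * Real.log (2 * A.δ * A.h) := by
    intro v hv
    rw [hW, Finset.mem_filter] at hv
    obtain ⟨hvV, hge⟩ := hv
    have hhv1 : (1 : ℝ) ≤ A.hv v := by linarith
    have hlogv : 0 ≤ Real.log (A.hv v : ℝ) := Real.log_nonneg hhv1
    have hf : (1 : ℝ) ≤ A.fv v := by exact_mod_cast A.one_le_fv v hvV
    have hp2 : (2 : ℝ) ≤ A.pv v := by exact_mod_cast (A.pv_prime v hvV).two_le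
    -- `2 log p_v ≥ log 4 ≥ 1`
    have hlogp : 1 ≤ 2 * Real.log (A.pv v : ℝ) := by
      have : Real.log 4 ≤ Real.log ((A.pv v : ℝ) ^ 2) :=
        Real.log_le_log (by norm_num) (by nlinarith)
      rw [Real.log_pow] at this
      have h4 : 1 ≤ Real.log (4 : ℝ) := by
        have he : Real.exp 1 ≤ 4 := by have := Real.exp_one_lt_d9; linarith
        calc (1 : ℝ) = Real.log (Real.exp 1) := (Real.log_exp 1).symm
          _ ≤ Real.log 4 := Real.log_le_log (Real.exp_pos 1) he
      push_cast at this; linarith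
    -- `h_v ≤ 2 δ h` hence `log h_v ≤ log(2δh)`
    have hterm_le : (A.hv v : ℝ) * (A.fv v : ℝ) * Real.log (A.pv v) ≤ (A.d : ℝ) * A.h := by
      rw [A.h_def]
      exact Finset.single_le_sum (fun w hw => A.term_nonneg w hw) hvV
    have hvle : (A.hv v : ℝ) ≤ 2 * A.δ * A.h := by
      have h1 : (A.hv v : ℝ) * 1 ≤ (A.hv v : ℝ) * ((A.fv v : ℝ) * (2 * Real.log (A.pv v))) := by
        apply mul_le_mul_of_nonneg_left _ (by positivity); nlinarith
      have h3 := mul_le_mul_of_nonneg_right A.d_le_δ hhpos.le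
      nlinarith
    have hloghv : Real.log (A.hv v : ℝ) ≤ Real.log (2 * A.δ * A.h) :=
      Real.log_le_log (by linarith) hvle
    -- assemble: `√h log h_v ≤ h_v log h_v ≤ h_v (2 f_v log p_v) log(2δh)`
    have a1 : Real.sqrt A.h * Real.log (A.hv v) ≤ (A.hv v : ℝ) * Real.log (A.hv v) :=
      mul_le_mul_of_nonneg_right hge hlogv
    have a2 : (A.hv v : ℝ) * Real.log (A.hv v) ≤ (A.hv v : ℝ) * Real.log (2 * A.δ * A.h) :=
      mul_le_mul_of_nonneg_left hloghv (by positivity)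
    have a3 : (A.hv v : ℝ) * Real.log (2 * A.δ * A.h) ≤
        (A.hv v : ℝ) * ((A.fv v : ℝ) * (2 * Real.log (A.pv v))) * Real.log (2 * A.δ * A.h) := by
      have : (A.hv v : ℝ) ≤ (A.hv v : ℝ) * ((A.fv v : ℝ) * (2 * Real.log (A.pv v))) := by
        have : (1 : ℝ) ≤ (A.fv v : ℝ) * (2 * Real.log (A.pv v)) := by nlinarith
        nlinarith
      exact mul_le_mul_of_nonneg_right this (by linarith)
    nlinarith
  have hsum : Real.sqrt A.h * ∑ v ∈ W, Real.log (A.hv v) ≤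
      2 * (∑ v ∈ W, (A.hv v : ℝ) * (A.fv v : ℝ) * Real.log (A.pv v)) * Real.log (2 * A.δ * A.h) := by
    rw [Finset.mul_sum, Finset.mul_sum, Finset.sum_mul]
    exact Finset.sum_le_sum hterm
  have hsub : ∑ v ∈ W, (A.hv v : ℝ) * (A.fv v : ℝ) * Real.log (A.pv v) ≤ (A.d : ℝ) * A.h := by
    rw [A.h_def]
    exact Finset.sum_le_sum_of_subset_of_nonneg (Finset.filter_subset _ _) fun v hv _ => A.term_nonneg v hv
  have hd : (A.d : ℝ) * A.h ≤ A.δ * A.h := mul_le_mul_of_nonneg_right A.d_le_δ hhpos.le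
  have hfinal : Real.sqrt A.h * ∑ v ∈ W, Real.log (A.hv v) ≤
      (2 * A.δ * Real.sqrt A.h * Real.log (2 * A.δ * A.h)) * Real.sqrt A.h := by
    have : 2 * ((A.d : ℝ) * A.h) * Real.log (2 * A.δ * A.h) ≤ 2 * (A.δ * A.h) * Real.log (2 * A.δ * A.h) := by
      nlinarith
    have e : 2 * (A.δ * A.h) * Real.log (2 * A.δ * A.h) =
        (2 * A.δ * Real.sqrt A.h * Real.log (2 * A.δ * A.h)) * Real.sqrt A.h := by
      linear_combination (2 * A.δ * Real.log (2 * A.δ * A.h)) * A.sq_sqrt_h.symm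
    nlinarith [Finset.sum_nonneg (fun v (hv : v ∈ W) => A.term_nonneg v (Finset.mem_filter.mp hv).1)]
  rw [mul_comm] at hfinal
  exact le_of_mul_le_mul_right hfinal hs0

/-- **[IUTchIV] Cor. 2.2 (ii), proof, (P1)–(P3) (pp. 44–45)**: there is a prime `l` with
(P1) `h^{1/2} ≤ l ≤ 10δ·h^{1/2}·log(2δ·h)`, (P2) `l` divides no nonzero `h_v`, (P3) `l = p_v ⟹ h_v < h^{1/2}`.
[claim: Mochizuki2012, status: disputed] -/
theorem exists_prime_P1_P2_P3 : ∃ l : ℕ, l.Prime ∧ Real.sqrt A.h ≤ l ∧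
    (l : ℝ) ≤ 10 * A.δ * Real.sqrt A.h * Real.log (2 * A.δ * A.h) ∧
    (∀ v ∈ A.V, A.hv v ≠ 0 → ¬ l ∣ A.hv v) ∧ (∀ v ∈ A.V, A.pv v = l → (A.hv v : ℝ) < Real.sqrt A.h) := by
  have hs := A.five_le_sqrt
  have hs0 : 0 < Real.sqrt A.h := by linarith
  have hlog1 := A.one_le_log
  have hδ := A.two_le_δ
  -- the set `A` of excluded primes: (S1) ∪ (S2′) ∪ (S3), with (S2′) = prime factors of the `h_v ≥ √h`
  set W := A.V.filter (fun v => Real.sqrt A.h ≤ A.hv v) with hW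
  set S1 : Finset ℕ := Nat.primesLE ⌊Real.sqrt A.h⌋₊ with hS1
  set S2 : Finset ℕ := W.biUnion (fun v => (A.hv v).primeFactors) with hS2
  set S3 : Finset ℕ := W.image A.pv with hS3
  obtain ⟨l, hlp, hlA, hlle⟩ := exists_prime_not_mem_le_of_isXiPrm A.isXiPrm (S1 ∪ S2 ∪ S3)
  have hl1 : l ∉ S1 := fun h => hlA (Finset.mem_union_left _ (Finset.mem_union_left _ h))
  have hl2 : l ∉ S2 := fun h => hlA (Finset.mem_union_left _ (Finset.mem_union_right _ h))
  have hl3 : l ∉ S3 := fun h => hlA (Finset.mem_union_right _ h)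
  -- (P1), lower bound: `l ∉ (S1)` means `l > ⌊√h⌋`, so `l > √h`
  have hP1lo : Real.sqrt A.h ≤ l := by
    have : ¬ (l ≤ ⌊Real.sqrt A.h⌋₊) := fun h => hl1 (by rw [hS1, Nat.mem_primesLE]; exact ⟨h, hlp⟩)
    have hlt : ⌊Real.sqrt A.h⌋₊ < l := by omega
    exact (Nat.lt_of_floor_lt hlt).le
  -- (P3): `h_v ≥ √h ⟹ p_v ≠ l`
  have hP3 : ∀ v ∈ A.V, A.pv v = l → (A.hv v : ℝ) < Real.sqrt A.h := by
    intro v hvV hpl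
    by_contra hge
    rw [not_lt] at hge
    exact hl3 (by rw [hS3, Finset.mem_image]; exact ⟨v, by rw [hW, Finset.mem_filter]; exact ⟨hvV, hge⟩, hpl⟩)
  -- (P2): if `l ∣ h_v ≠ 0` then either `h_v ≥ √h` (excluded by (S2′)) or `l ≤ h_v < √h` (excluded by (S1))
  have hP2 : ∀ v ∈ A.V, A.hv v ≠ 0 → ¬ l ∣ A.hv v := by
    intro v hvV hne hdvd
    rcases le_or_gt (Real.sqrt A.h) (A.hv v) with hge | hlt
    · exact hl2 (by
        rw [hS2, Finset.mem_biUnion]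
        exact ⟨v, by rw [hW, Finset.mem_filter]; exact ⟨hvV, hge⟩,
          Nat.mem_primeFactors.mpr ⟨hlp, hdvd, hne⟩⟩)
    · have hle : (l : ℝ) ≤ A.hv v := by exact_mod_cast Nat.le_of_dvd (Nat.pos_of_ne_zero hne) hdvd
      linarith
  -- (P1), upper bound: `l ≤ 2(θ_A + ξ) ≤ 10 δ √h log(2δh)`
  have hθ : thetaSet (S1 ∪ S2 ∪ S3) ≤
      2 * Real.sqrt A.h + A.δ * Real.sqrt A.h + 2 * A.δ * Real.sqrt A.h * Real.log (2 * A.δ * A.h) := by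
    have hsplit := sum_union3_le S1 S2 S3 (fun p => Real.log p) (fun n => Real.log_natCast_nonneg n)
    -- (S1): `θ(√h) ≤ (4/3)√h ≤ 2√h`
    have h1 : ∑ p ∈ S1, Real.log (p : ℝ) ≤ 2 * Real.sqrt A.h := by
      have hθ1 : θ (Real.sqrt A.h) = ∑ p ∈ S1, Real.log (p : ℝ) := by
        rw [Chebyshev.theta_eq_sum_primesLE]
      have := (A.isXiPrm.2 (Real.sqrt A.h) A.ξ_le_sqrt).2
      rw [hθ1] at this; linarith
    -- (S2′): `Σ ≤ Σ_{h_v ≥ √h} log h_v ≤ 2δ√h log(2δh)`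
    have h2 : ∑ p ∈ S2, Real.log (p : ℝ) ≤ 2 * A.δ * Real.sqrt A.h * Real.log (2 * A.δ * A.h) := by
      refine le_trans (sum_biUnion_le_sum W _ _ (fun n => Real.log_natCast_nonneg n)) ?_
      refine le_trans (Finset.sum_le_sum fun v hv => ?_) A.sum_log_hv_le
      have hv' : Real.sqrt A.h ≤ A.hv v := (Finset.mem_filter.mp hv).2
      exact sum_log_primeFactors_le (by
        intro h0; rw [h0] at hv'; push_cast at hv'; linarith)
    -- (S3): `Σ ≤ Σ_{h_v ≥ √h} log p_v ≤ δ√h`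
    have h3 : ∑ p ∈ S3, Real.log (p : ℝ) ≤ A.δ * Real.sqrt A.h :=
      le_trans (sum_image_le_sum W A.pv _ (fun n => Real.log_natCast_nonneg n)) A.sum_log_pv_le
    unfold thetaSet
    linarith
  have hξs : A.ξ ≤ Real.sqrt A.h := A.ξ_le_sqrt
  have hP1hi : (l : ℝ) ≤ 10 * A.δ * Real.sqrt A.h * Real.log (2 * A.δ * A.h) := by
    -- `2√h + δ√h ≤ 2δ√h log(2δh)` and `2ξ ≤ 2√h ≤ 2δ√h log(2δh)`
    have hsl : 0 ≤ Real.sqrt A.h * Real.log (2 * A.δ * A.h) := by positivity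
    nlinarith
  exact ⟨l, hlp, hP1lo, hP1hi, hP2, hP3⟩

end PrimeChoiceData

end Cor22

end Literature.IUT.LogVolume

end
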